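import Summits.Ventures.CertifiedQuantumChemistry.Rows.SectorRows
import Literature.MathematicalPhysics.QuantumLattice.SiteBijectionSectorTransport
import HarnessLib

/-!
# Ventures/CertifiedQuantumChemistry — Rows/OrbitalRelabelling.lean: the certified quantities, the row predicates and
# the certificates do not depend on the ORBITAL ORDER of the model (`site_perm` of the MPS pipeline; any reordering of
# an integral file)

HONEST FRAMING (verbatim): certified bounds for a stated model Hamiltonian in a stated basis; not a
claim about the real molecule beyond that model.

var-2 (gen 12), zero compute, PROVED glue only (0 sorry, no definition, no claim node; nothing here asserts a bound
about any model). Every MPS of the cell above `k = 10` is produced and certified in a REORDERED orbital basis (block2's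
Fiedler / genetic orderings; FORMAT-qcmps0 §2: "orbital `p` sits at site `j = site_perm⁻¹[p]`"), i.e. the kernel chain
`Rows/SweepContraction` → `Rows/MPSUpperBound` → `Rows/MPOAutomaton` speaks about the model `F'` whose orbital index IS
the site index, `F'.h j j' = F.h (π j) (π j')`, `F'.eri j₁ j₂ j₃ j₄ = F.eri (π j₁) (π j₂) (π j₃) (π j₄)`, `F'.ecore =
F.ecore` with `π = site_perm`, while the rows of `CERTIFIED.md` and the `Hamiltonians/*.lean` tables are stated for `F`
(the integral file's own order). The same happens whenever any producer (DMRG, selected CI, an SDP generator's orbital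
blocking) works in its own orbital order. This file proves, for every `k`, every permutation `π` and every pair of models
so related (hypotheses `hh`, `heri`, `hcore`; no `Model.reindex` definition is introduced):

* §Operator (any finite linearly ordered site types `Λ ≃ Λ'`) — covariance under the tree's second-quantised orbital
  bijection `relabel (Orb.mapEquiv f)` (`Literature/…/QuantumLattice/FermionRelabelling`: `Γ c_i Γ⁻¹ = c_{f i}`) of the
  singlet / two-electron excitation operators and of **`molecularHamiltonian`** with pulled-back integral tables
  (`relabel_mapEquiv_molecularHamiltonian`); invariance of the `(N_α, N_β)` sector
  energy (`sectorGroundEnergy_relabel_mapEquiv`, from `minEnergyOn_relabel_szSector` of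
  `Literature/…/SiteBijectionSectorTransport`); transport of `IsInSector` along the signed permutation of Fock vectors
  `relabelVec` (`isInSector_relabelVec_mapEquiv`); and a transport lemma for `minEnergyOn` between any two subspaces the
  signed permutation identifies (`minEnergyOn_relabel_of_transport`, the proof pattern of `minEnergyOn_relabel_szSector`).
* §Model (`F F' : Model k`, `π : Equiv.Perm (Fin k)`) — `relabel (Orb.mapEquiv π) F'.hamiltonian = F.hamiltonian`;
  `F'.IsSymmetric ↔ F.IsSymmetric`; **`F'.energy a b = F.energy a b`** and **`F'.singletEnergy n = F.singletEnergy n`**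
  (the singlet subspace `szSector ⊓ ker Ŝ⁺` is mapped onto itself); hence `LowerRow` / `UpperRow` / `Bracket` /
  `SingletLowerRow` / `SingletUpperRow` / `SingletBracket` for `F'` and for `F` are EQUIVALENT; an `UpperCertificate`
  (explicit sector vector with Rayleigh data) for `F'` is transported to one for `F` with the same constant
  (`upperCertificate_of_perm`: the witness is `Γ_π ψ`, same norm, same `⟨ψ, Hψ⟩`, same sector); and a `LowerCertificate`
  (exact SOS / commutator / sector-ideal identity) for `F'` is transported to one for `F` with the SAME Gram matrix,
  constant and residual coefficients (`lowerCertificate_of_perm`: conjugate the identity by the algebra isomorphism `Γ_π`;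
  §LowerIngredients: Gram forms, ladder words and their two charges, the sector ideals are covariant).

So a certificate of any class issued in a producer's orbital order proves the row of the integral file's order by ONE
rewrite, the only per-instance datum being the permutation (which the state / problem files print: `site_perm` of
FORMAT-qcmps0 §1, the orbital maps of the SDP layouts). What is NOT claimed: nothing about which order a given file used
(reader data); no statement about point-group or spin relabellings (`Rows/SpinSectors.lean` has the spin flip); no row,
no certificate, no claim node is instantiated.
References: O. Bratteli, D. W. Robinson, *Operator Algebras and Quantum Statistical Mechanics II* (1997) §5.2.2,
Thm. 5.2.5 (orbital bijections are unitarily implemented on Fock space); T. Helgaker, P. Jørgensen, J. Olsen,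
*Molecular Electronic-Structure Theory* (2000) §2.2, §3.2 (orbital transformations of the second-quantised Hamiltonian;
a permutation is the special case of a unitary orbital rotation with a permutation matrix); G. K.-L. Chan,
M. Head-Gordon, J. Chem. Phys. 116 (2002) 4462, §II.C and G. Barcza, Ö. Legeza, K. H. Marti, M. Reiher, Phys. Rev. A 83
(2011) 012508 (orbital ordering in QC-DMRG; Fiedler ordering); FORMAT-qcmps0 §1–§2 (HOME `pub-qchem-var2/`).
-/

noncomputable section

namespace Summit.Ventures.CertifiedQuantumChemistry

open Matrix Finset
open Literature.MathematicalPhysics.QuantumLattice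
open Literature.MathematicalPhysics.QuantumChemistry

/-! ## Covariance of the molecular Hamiltonian under orbital bijections -/

section Operator

variable {Λ Λ' : Type*} [LinearOrder Λ] [Fintype Λ] [LinearOrder Λ'] [Fintype Λ']

omit [LinearOrder Λ] [LinearOrder Λ'] in
/-- Reindexing a double sum along a bijection: `Σ_{p q} φ (f p) (f q) = Σ_{p q} φ p q`. [folklore] -/
private theorem sum_sum_comp_equiv {M : Type*} [AddCommMonoid M] (f : Λ ≃ Λ') (φ : Λ' → Λ' → M) :
    ∑ p, ∑ q, φ (f p) (f q) = ∑ p, ∑ q, φ p q :=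
  (Finset.sum_congr rfl fun p _ => f.sum_comp (φ (f p))).trans (f.sum_comp fun p => ∑ q, φ p q)

omit [LinearOrder Λ] [LinearOrder Λ'] in
/-- Reindexing a fourfold sum along a bijection. [folklore] -/
private theorem sum_sum_sum_sum_comp_equiv {M : Type*} [AddCommMonoid M] (f : Λ ≃ Λ')
    (φ : Λ' → Λ' → Λ' → Λ' → M) :
    ∑ p, ∑ q, ∑ r, ∑ s, φ (f p) (f q) (f r) (f s) = ∑ p, ∑ q, ∑ r, ∑ s, φ p q r s :=
  (Finset.sum_congr rfl fun p _ => Finset.sum_congr rfl fun q _ =>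
      sum_sum_comp_equiv f (φ (f p) (f q))).trans (sum_sum_comp_equiv f fun p q => ∑ r, ∑ s, φ p q r s)

/-- **`Γ E_pq Γ⁻¹ = E_{f p, f q}`**: the singlet excitation operators are covariant under the second quantisation
`relabel (Orb.mapEquiv f)` of a site (spatial-orbital) bijection `f`. [folklore; Helgaker–Jørgensen–Olsen (2000) §3.2] -/
theorem relabel_mapEquiv_singletExcitation (f : Λ ≃ Λ') (p q : Λ) :
    relabel (Orb.mapEquiv f) (singletExcitation p q) = singletExcitation (f p) (f q) := by
  rw [singletExcitation, singletExcitation, map_sum]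
  simp_rw [map_mul, relabel_creation, relabel_annihilation, Orb.mapEquiv_orb]

/-- **`Γ e_pqrs Γ⁻¹ = e_{f p, f q, f r, f s}`** for the two-electron excitation operators. [folklore] -/
theorem relabel_mapEquiv_twoElectronExcitation (f : Λ ≃ Λ') (p q r s : Λ) :
    relabel (Orb.mapEquiv f) (twoElectronExcitation p q r s) =
      twoElectronExcitation (f p) (f q) (f r) (f s) := by
  rw [twoElectronExcitation, twoElectronExcitation, map_sum]
  simp_rw [map_sum, map_mul, relabel_creation, relabel_annihilation, Orb.mapEquiv_orb]

/-- **Covariance of the second-quantised molecular Hamiltonian under an orbital bijection.** If the integral tables on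
`Λ` are the tables `h`, `g` on `Λ'` PULLED BACK along `f : Λ ≃ Λ'` (`h' p q = h (f p) (f q)`,
`g' p q r s = g (f p) (f q) (f r) (f s)`, same scalar), then `Γ_f Ĥ(h', g', h_nuc) Γ_f⁻¹ = Ĥ(h, g, h_nuc)`: relabelling
the orbitals of an integral file is implemented by a unitary on Fock space. [folklore; Bratteli–Robinson II Thm. 5.2.5,
Helgaker–Jørgensen–Olsen (2000) §3.2 with a permutation matrix] -/
theorem relabel_mapEquiv_molecularHamiltonian (f : Λ ≃ Λ') (h : Λ' → Λ' → ℂ) (g : Λ' → Λ' → Λ' → Λ' → ℂ)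
    (hnuc : ℂ) :
    relabel (Orb.mapEquiv f) (molecularHamiltonian (fun p q => h (f p) (f q))
        (fun p q r s => g (f p) (f q) (f r) (f s)) hnuc) = molecularHamiltonian h g hnuc := by
  unfold molecularHamiltonian
  simp only [map_add, map_smul, map_sum, map_one, relabel_mapEquiv_singletExcitation,
    relabel_mapEquiv_twoElectronExcitation]
  rw [sum_sum_comp_equiv f fun p q => h p q • singletExcitation p q,
    sum_sum_sum_sum_comp_equiv f fun p q r s => g p q r s • twoElectronExcitation p q r s]

/-- **The `(N_α, N_β)`-sector ground energy is invariant under site bijections**: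
`E₀(Γ_f H Γ_f⁻¹; a, b) = E₀(H; a, b)` (`sectorGroundEnergy` is `minEnergyOn` of the joint `(N, S^z)` sector, which the
signed permutation maps onto itself: `minEnergyOn_relabel_szSector` of `Literature/…/SiteBijectionSectorTransport`).
[folklore; Bratteli–Robinson II Thm. 5.2.5] -/
theorem sectorGroundEnergy_relabel_mapEquiv (f : Λ ≃ Λ') (H : Matrix (Finset (Orb Λ)) (Finset (Orb Λ)) ℂ)
    (a b : ℕ) :
    sectorGroundEnergy (relabel (Orb.mapEquiv f) H) a b = sectorGroundEnergy H a b := by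
  rw [sectorGroundEnergy_def, sectorGroundEnergy_def, minEnergyOn_relabel_szSector]

/-- The signed permutation `Γ_f` of Fock vectors maps the `(a, b)` determinant sector into the `(a, b)` sector
(`IsInSector`, the support condition of an upper certificate's witness). [folklore] -/
theorem isInSector_relabelVec_mapEquiv (f : Λ ≃ Λ') {a b : ℕ} {ψ : Fock (Orb Λ)} (hψ : IsInSector a b ψ) :
    IsInSector a b (relabelVec (Orb.mapEquiv f) ψ) :=
  (mem_szSector_iff_isInSector a b _).1
    (mem_szSector_relabelVec f ((mem_szSector_iff_isInSector a b ψ).2 hψ))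

/-- **Transport of a sector energy along a signed permutation.** For an orbital bijection `e` and subspaces `K`, `K'`
of the two Fock spaces that `Γ_e` identifies (`Γ_e K ⊆ K'` and `Γ_e ψ ∈ K' → ψ ∈ K`), the lowest energy of
`Γ_e H Γ_e⁻¹` on `K'` is the lowest energy of `H` on `K` (`Γ_e` is unitary: same unit sphere, same expectations). The
proof pattern of `minEnergyOn_relabel_szSector`, stated once for any pair of sectors. [folklore] -/
theorem minEnergyOn_relabel_of_transport {ι ι' : Type*} [LinearOrder ι] [Fintype ι] [LinearOrder ι'] [Fintype ι']
    (e : ι ≃ ι') (H : Matrix (Finset ι) (Finset ι) ℂ) (K : Submodule ℂ (Fock ι)) (K' : Submodule ℂ (Fock ι'))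
    (hK : ∀ ψ, ψ ∈ K → relabelVec e ψ ∈ K') (hK' : ∀ ψ, relabelVec e ψ ∈ K' → ψ ∈ K) :
    (relabel e H).minEnergyOn K' = H.minEnergyOn K := by
  unfold Matrix.minEnergyOn
  congr 1
  ext E
  constructor
  · rintro ⟨ψ', hmem, h1, rfl⟩
    have hψ' : relabelVec e (relabelVecInv e ψ') = ψ' := relabelVec_relabelVecInv e ψ'
    refine ⟨relabelVecInv e ψ', hK' _ (by rw [hψ']; exact hmem), ?_, ?_⟩
    · rw [← star_relabelVec_dotProduct e, hψ', h1]
    · rw [← hψ', relabel_mulVec_relabelVec, star_relabelVec_dotProduct, hψ']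
  · rintro ⟨ψ, hmem, h1, rfl⟩
    exact ⟨relabelVec e ψ, hK ψ hmem, by rw [star_relabelVec_dotProduct, h1],
      by rw [relabel_mulVec_relabelVec, star_relabelVec_dotProduct]⟩

end Operator


/-! ### Relabelling the ingredients of a lower certificate (Gram forms, ladder words, charges) -/

section LowerIngredients

variable {ι ι' : Type*} [LinearOrder ι] [Fintype ι] [LinearOrder ι'] [Fintype ι']

/-- `Γ a⋆ Γ⁻¹ = (Γ a Γ⁻¹)⋆` (`relabel_conjTranspose` in `star` notation). [folklore] -/
theorem relabel_star (e : ι ≃ ι') (a : Matrix (Finset ι) (Finset ι) ℂ) :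
    relabel e (star a) = star (relabel e a) := by
  rw [Matrix.star_eq_conjTranspose, Matrix.star_eq_conjTranspose, relabel_conjTranspose]

/-- **Gram forms are covariant**: `Γ (Σ_IJ Λ_IJ O_I⋆ O_J) Γ⁻¹ = Σ_IJ Λ_IJ (Γ O_I Γ⁻¹)⋆ (Γ O_J Γ⁻¹)` — the SAME PSD
coefficient matrix over the relabelled operator family. [folklore] -/
theorem relabel_gramForm {m : Type*} [Fintype m] (e : ι ≃ ι') (Λm : Matrix m m ℂ)
    (O : m → Matrix (Finset ι) (Finset ι) ℂ) :
    relabel e (Literature.MathematicalPhysics.QuantumManyBody.StateRelaxation.gramForm Λm O) =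
      Literature.MathematicalPhysics.QuantumManyBody.StateRelaxation.gramForm Λm fun i => relabel e (O i) := by
  unfold Literature.MathematicalPhysics.QuantumManyBody.StateRelaxation.gramForm
  simp only [map_sum, map_smul, map_mul, relabel_star]

/-- A ladder letter is relabelled to the ladder letter of the image orbital (same `dag` flag). [folklore] -/
theorem relabel_ladderLetter (e : ι ≃ ι') (p : ι × Bool) :
    relabel e (ladderLetter p) = ladderLetter (e p.1, p.2) := by
  obtain ⟨i, b⟩ := p
  cases b
  · simp only [ladderLetter, Bool.false_eq_true, if_false, relabel_annihilation]
  · simp only [ladderLetter, if_true, relabel_creation]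

/-- **Ladder words are covariant**: `Γ (a₁⋯aₙ) Γ⁻¹` is the ladder word of the relabelled letters. [folklore] -/
theorem relabel_ladderWord (e : ι ≃ ι') (l : List (ι × Bool)) :
    relabel e (ladderWord l) = ladderWord (l.map fun p => (e p.1, p.2)) := by
  induction l with
  | nil => rw [List.map_nil, ladderWord_nil, ladderWord_nil, map_one]
  | cons p l ih => rw [List.map_cons, ladderWord_cons, ladderWord_cons, map_mul, relabel_ladderLetter, ih]

omit [LinearOrder ι] [Fintype ι] [LinearOrder ι'] [Fintype ι'] in
/-- Relabelling the letters does not change a word's charge `#creators − #annihilators`. [folklore] -/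
theorem ladderCharge_map_relabel (e : ι ≃ ι') (l : List (ι × Bool)) :
    ladderCharge (l.map fun p => (e p.1, p.2)) = ladderCharge l := by
  induction l with
  | nil => rfl
  | cons p l ih => rw [List.map_cons, ladderCharge_cons, ladderCharge_cons, ih]

/-- A site bijection keeps the spin label, hence the `2S^z`-charge of a ladder letter:
`spinCharge (Orb.mapEquiv f i, dag) = spinCharge (i, dag)`. [folklore] -/
theorem letterSpinCharge_mapEquiv {Λ Λ' : Type*} (f : Λ ≃ Λ') (p : Orb Λ × Bool) :
    letterSpinCharge (Orb.mapEquiv f p.1, p.2) = letterSpinCharge p := rfl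

/-- Relabelling the letters along a site bijection does not change a word's `2S^z`-charge. [folklore] -/
theorem ladderSpinCharge_map_mapEquiv {Λ Λ' : Type*} (f : Λ ≃ Λ') (l : List (Orb Λ × Bool)) :
    ladderSpinCharge (l.map fun p => (Orb.mapEquiv f p.1, p.2)) = ladderSpinCharge l := by
  induction l with
  | nil => rfl
  | cons p l ih => rw [List.map_cons, ladderSpinCharge_cons, ladderSpinCharge_cons, ih, letterSpinCharge_mapEquiv]

end LowerIngredients

/-! ## Two models related by an orbital permutation have the same rows and certificates -/

section Model

variable {k : ℕ} {F F' : Model k} (π : Equiv.Perm (Fin k))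

/-- The Hamiltonian of the reordered model `F'` (`F'.h j j' = F.h (π j) (π j')`, `F'.eri` likewise, same `ecore`) is the
molecular Hamiltonian of `F`'s tables pulled back along `π`. -/
theorem Model.hamiltonian_eq_of_perm (hh : ∀ p q, F'.h p q = F.h (π p) (π q))
    (heri : ∀ p q r s, F'.eri p q r s = F.eri (π p) (π q) (π r) (π s)) (hcore : F'.ecore = F.ecore) :
    F'.hamiltonian = molecularHamiltonian (fun p q => ((F.h (π p) (π q) : ℚ) : ℂ))
      (fun p q r s => ((F.eri (π p) (π q) (π r) (π s) : ℚ) : ℂ)) ((F.ecore : ℚ) : ℂ) := by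
  unfold Model.hamiltonian
  simp only [hh, heri, hcore]

/-- **`Γ_π H_{F'} Γ_π⁻¹ = H_F`**: the second quantisation of the orbital permutation `π` conjugates the reordered model's
Hamiltonian to the original one. -/
theorem Model.relabel_hamiltonian_of_perm (hh : ∀ p q, F'.h p q = F.h (π p) (π q))
    (heri : ∀ p q r s, F'.eri p q r s = F.eri (π p) (π q) (π r) (π s)) (hcore : F'.ecore = F.ecore) :
    relabel (Orb.mapEquiv π) F'.hamiltonian = F.hamiltonian := by
  rw [Model.hamiltonian_eq_of_perm π hh heri hcore]
  exact relabel_mapEquiv_molecularHamiltonian π (fun p q => ((F.h p q : ℚ) : ℂ))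
    (fun p q r s => ((F.eri p q r s : ℚ) : ℂ)) ((F.ecore : ℚ) : ℂ)

/-- The integral symmetries are order-independent: `F'.IsSymmetric ↔ F.IsSymmetric`. -/
theorem Model.isSymmetric_iff_of_perm (hh : ∀ p q, F'.h p q = F.h (π p) (π q))
    (heri : ∀ p q r s, F'.eri p q r s = F.eri (π p) (π q) (π r) (π s)) :
    F'.IsSymmetric ↔ F.IsSymmetric := by
  unfold Model.IsSymmetric
  simp only [hh, heri]
  constructor
  · rintro ⟨h1, h2⟩
    exact ⟨fun p q => by simpa using h1 (π.symm p) (π.symm q),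
      fun p q r s => by simpa using h2 (π.symm p) (π.symm q) (π.symm r) (π.symm s)⟩
  · rintro ⟨h1, h2⟩
    exact ⟨fun p q => h1 _ _, fun p q r s => h2 _ _ _ _⟩

/-- **THE CERTIFIED QUANTITY IS ORDER-INDEPENDENT: `E₀(H_{F'}; a, b) = E₀(H_F; a, b)`** for every sector `(a, b)`
(including the junk range, where both sides are `0`). -/
theorem Model.energy_eq_of_perm (hh : ∀ p q, F'.h p q = F.h (π p) (π q))
    (heri : ∀ p q r s, F'.eri p q r s = F.eri (π p) (π q) (π r) (π s)) (hcore : F'.ecore = F.ecore)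
    (a b : ℕ) : F'.energy a b = F.energy a b := by
  unfold Model.energy
  rw [← Model.relabel_hamiltonian_of_perm π hh heri hcore, sectorGroundEnergy_relabel_mapEquiv]

/-- Lower rows of the reordered and of the original model are equivalent. -/
theorem lowerRow_iff_of_perm (hh : ∀ p q, F'.h p q = F.h (π p) (π q))
    (heri : ∀ p q r s, F'.eri p q r s = F.eri (π p) (π q) (π r) (π s)) (hcore : F'.ecore = F.ecore)
    {a b : ℕ} {lo : ℚ} : LowerRow F' a b lo ↔ LowerRow F a b lo := by
  unfold LowerRow
  rw [Model.energy_eq_of_perm π hh heri hcore]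

/-- Upper rows of the reordered and of the original model are equivalent (an MPS upper row certified in `site_perm`
order IS the upper row of the integral file's order). -/
theorem upperRow_iff_of_perm (hh : ∀ p q, F'.h p q = F.h (π p) (π q))
    (heri : ∀ p q r s, F'.eri p q r s = F.eri (π p) (π q) (π r) (π s)) (hcore : F'.ecore = F.ecore)
    {a b : ℕ} {hi : ℚ} : UpperRow F' a b hi ↔ UpperRow F a b hi := by
  unfold UpperRow
  rw [Model.energy_eq_of_perm π hh heri hcore]

/-- Two-sided rows of the reordered and of the original model are equivalent. -/
theorem bracket_iff_of_perm (hh : ∀ p q, F'.h p q = F.h (π p) (π q))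
    (heri : ∀ p q r s, F'.eri p q r s = F.eri (π p) (π q) (π r) (π s)) (hcore : F'.ecore = F.ecore)
    {a b : ℕ} {lo hi : ℚ} : Bracket F' a b lo hi ↔ Bracket F a b lo hi := by
  unfold Bracket
  rw [lowerRow_iff_of_perm π hh heri hcore, upperRow_iff_of_perm π hh heri hcore]

/-- **Transport of an UPPER CERTIFICATE** (explicit sector vector with Rayleigh data, `Rows/SectorRows.lean`): a witness
`ψ` for the reordered model `F'` — e.g. the vector of an MPS in `site_perm` order (`Rows/MPSUpperBound.lean`) or of a
CI expansion over reordered orbitals — gives the witness `Γ_π ψ` for `F` with the SAME constant: same sector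
(`isInSector_relabelVec_mapEquiv`), nonzero (`Γ_π` is injective), same `⟨ψ, ψ⟩` and same `⟨ψ, Hψ⟩` (`Γ_π` is unitary and
conjugates `H_{F'}` to `H_F`). -/
theorem upperCertificate_of_perm (hh : ∀ p q, F'.h p q = F.h (π p) (π q))
    (heri : ∀ p q r s, F'.eri p q r s = F.eri (π p) (π q) (π r) (π s)) (hcore : F'.ecore = F.ecore)
    {a b : ℕ} {hi : ℚ} (h : UpperCertificate F' a b hi) : UpperCertificate F a b hi := by
  obtain ⟨ψ, hψ, h0, hu⟩ := h
  refine ⟨relabelVec (Orb.mapEquiv π) ψ, isInSector_relabelVec_mapEquiv π hψ, ?_, ?_⟩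
  · intro h
    exact h0 (relabelVec_injective _ (by rw [h, relabelVec_zero]))
  · rw [← Model.relabel_hamiltonian_of_perm π hh heri hcore, relabel_mulVec_relabelVec,
      star_relabelVec_dotProduct, star_relabelVec_dotProduct]
    exact hu

/-- **Transport of a LOWER CERTIFICATE** (`Rows/SectorRows.lean`: an exact SOS / commutator / sector-ideal identity for
`H_{F'} − c`). Conjugating the identity by `Γ_π` (an algebra isomorphism fixing `1`, commuting with `⋆`, sending
`H_{F'} ↦ H_F`, `n_{yσ} ↦ n_{π y, σ}` — so the sector ideals `(N̂_↑ − a)`, `(N̂_↓ − b)` to themselves — and ladder words to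
ladder words of the same charges) gives a certificate for `F` with the SAME Gram matrix, the SAME constant `c` and the
SAME residual coefficients, hence the same `lo`: an SDP certificate issued in a generator's orbital order proves the
lower row of the integral file's order. -/
theorem lowerCertificate_of_perm (hh : ∀ p q, F'.h p q = F.h (π p) (π q))
    (heri : ∀ p q r s, F'.eri p q r s = F.eri (π p) (π q) (π r) (π s)) (hcore : F'.ecore = F.ecore)
    {a b : ℕ} {lo : ℚ} (h : LowerCertificate F' a b lo) : LowerCertificate F a b lo := by
  obtain ⟨n, nX, nZ, nS, nC, nV, nR, Λm, hΛm, O, X, Z, Z', S, S', bc, cw, hcw, dc, V, ac, v, c, hlo, hcert⟩ := h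
  have hNa : ∑ y : Fin k, numberOp (π y) (0 : Fin 2) = ∑ y : Fin k, numberOp y 0 :=
    Equiv.sum_comp π fun y => numberOp y 0
  have hNb : ∑ y : Fin k, numberOp (π y) (1 : Fin 2) = ∑ y : Fin k, numberOp y 1 :=
    Equiv.sum_comp π fun y => numberOp y 1
  have key := congrArg (relabel (Orb.mapEquiv π)) hcert
  simp only [map_sub, map_add, map_sum, map_smul, map_mul, map_one,
    Model.relabel_hamiltonian_of_perm π hh heri hcore, relabel_gramForm, relabel_ladderWord,
    relabel_mapEquiv_numberOp, relabel_conjTranspose, hNa, hNb] at key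
  refine ⟨n, nX, nZ, nS, nC, nV, nR, Λm, hΛm, fun i => relabel (Orb.mapEquiv π) (O i),
    fun i => relabel (Orb.mapEquiv π) (X i), fun i => relabel (Orb.mapEquiv π) (Z i),
    fun i => relabel (Orb.mapEquiv π) (Z' i), fun i => relabel (Orb.mapEquiv π) (S i),
    fun i => relabel (Orb.mapEquiv π) (S' i), bc, fun j => (cw j).map fun p => (Orb.mapEquiv π p.1, p.2),
    fun j => ?_, dc, fun i => relabel (Orb.mapEquiv π) (V i), ac,
    fun j => (v j).map fun p => (Orb.mapEquiv π p.1, p.2), c, hlo, ?_⟩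
  · rw [ladderCharge_map_relabel, ladderSpinCharge_map_mapEquiv]
    exact hcw j
  · beta_reduce
    exact key

/-- The singlet subspace `szSector (2n, S^z = 0) ⊓ ker Ŝ⁺` is mapped onto itself by the signed permutation `Γ_π`
(`Ŝ⁺` and the joint sectors are invariant). -/
theorem relabelVec_mem_singletSector_iff {n : ℕ} (ψ : Fock (Orb (Fin k))) :
    relabelVec (Orb.mapEquiv π) ψ ∈ singletSector k n ↔ ψ ∈ singletSector k n := by
  rw [mem_singletSector_iff, mem_singletSector_iff]
  -- `Γ_π Ŝ⁺ Γ_π⁻¹ = Ŝ⁺`: `(x, σ) ↦ (π x, σ)` keeps the spin label (cf. `relabel_mapEquiv_totalNumber`)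
  have hplus : relabel (Orb.mapEquiv π) (spinPlus : Op k) = spinPlus := by
    rw [spinPlus, map_sum]
    simp_rw [map_mul, relabel_creation, relabel_annihilation, Orb.mapEquiv_orb]
    exact Equiv.sum_comp π fun x => creation (orb x 0) * annihilation (orb x 1)
  have hS : spinPlus *ᵥ relabelVec (Orb.mapEquiv π) ψ = relabelVec (Orb.mapEquiv π) (spinPlus *ᵥ ψ) := by
    rw [← relabel_mulVec_relabelVec, hplus]
  rw [hS]
  constructor
  · rintro ⟨h1, h2⟩
    exact ⟨mem_szSector_of_relabelVec_mem π h1, relabelVec_injective _ (by rw [h2, relabelVec_zero])⟩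
  · rintro ⟨h1, h2⟩
    exact ⟨mem_szSector_relabelVec π h1, by rw [h2, relabelVec_zero]⟩

/-- **THE SINGLET QUANTITY IS ORDER-INDEPENDENT: `E₀(H_{F'}; N = 2n, S = 0) = E₀(H_F; N = 2n, S = 0)`.** -/
theorem Model.singletEnergy_eq_of_perm (hh : ∀ p q, F'.h p q = F.h (π p) (π q))
    (heri : ∀ p q r s, F'.eri p q r s = F.eri (π p) (π q) (π r) (π s)) (hcore : F'.ecore = F.ecore)
    (n : ℕ) : F'.singletEnergy n = F.singletEnergy n := by
  unfold Model.singletEnergy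
  rw [← Model.relabel_hamiltonian_of_perm π hh heri hcore]
  exact (minEnergyOn_relabel_of_transport (Orb.mapEquiv π) F'.hamiltonian (singletSector k n)
    (singletSector k n) (fun ψ h => (relabelVec_mem_singletSector_iff π ψ).2 h)
    (fun ψ h => (relabelVec_mem_singletSector_iff π ψ).1 h)).symm

/-- Singlet lower rows of the reordered and of the original model are equivalent. -/
theorem singletLowerRow_iff_of_perm (hh : ∀ p q, F'.h p q = F.h (π p) (π q))
    (heri : ∀ p q r s, F'.eri p q r s = F.eri (π p) (π q) (π r) (π s)) (hcore : F'.ecore = F.ecore)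
    {n : ℕ} {lo : ℚ} : SingletLowerRow F' n lo ↔ SingletLowerRow F n lo := by
  unfold SingletLowerRow
  rw [Model.singletEnergy_eq_of_perm π hh heri hcore]

/-- Singlet upper rows of the reordered and of the original model are equivalent. -/
theorem singletUpperRow_iff_of_perm (hh : ∀ p q, F'.h p q = F.h (π p) (π q))
    (heri : ∀ p q r s, F'.eri p q r s = F.eri (π p) (π q) (π r) (π s)) (hcore : F'.ecore = F.ecore)
    {n : ℕ} {hi : ℚ} : SingletUpperRow F' n hi ↔ SingletUpperRow F n hi := by
  unfold SingletUpperRow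
  rw [Model.singletEnergy_eq_of_perm π hh heri hcore]

/-- Two-sided singlet rows of the reordered and of the original model are equivalent. -/
theorem singletBracket_iff_of_perm (hh : ∀ p q, F'.h p q = F.h (π p) (π q))
    (heri : ∀ p q r s, F'.eri p q r s = F.eri (π p) (π q) (π r) (π s)) (hcore : F'.ecore = F.ecore)
    {n : ℕ} {lo hi : ℚ} : SingletBracket F' n lo hi ↔ SingletBracket F n lo hi := by
  unfold SingletBracket
  rw [singletLowerRow_iff_of_perm π hh heri hcore, singletUpperRow_iff_of_perm π hh heri hcore]

end Model

end Summit.Ventures.CertifiedQuantumChemistry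

end
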